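import Literature.MathematicalPhysics.QuantumFieldTheory.Balaban1983to89.B1Eq324BenfattoKernelSect5PolyClusters
import Literature.MathematicalPhysics.QuantumFieldTheory.Balaban1983to89.B1Eq324BenfattoSect5TupleClustersDecay
import HarnessLib

/-!
# `Balaban1983to89.B1Eq324BenfattoKernelSect5TupleClustersDecay` — [BenfattoEtAl1978] Appendix D p. 166 / §5 p. 159: the Appendix D
# bound for polynomial / tuple-class slots with the decay distributed as a WEIGHT ON EVERY SLOT'S MASS, FOR A GENERAL SHIFTED GAUSSIAN
# KERNEL FIELD `𝒩(0,K)∘(u + ·)⁻¹` — `|𝓔^T_{μ_{K,u}}(Y₁,…,Y_k)| ≤ C·Π_j 𝓜̃_j^{(δ/2k)·ρ}` with the covariance decay, the diagonal and the centre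
# bound DISPLAYED AS ROWS — PROVED (row 4 of the cluster-side port map; the extensive form the CROSS sums of the free-side identification consume)

statement-level skeleton of published theorems with citation tags; proofs where landed; nothing here is a claim about the
Yang–Mills mass gap

WHY THIS MODULE (cell `pub-ymgap`, seat `dag-n08-b` gen 12 by the cluster lane's word; node N08 [Balaban1985UV3]; the [BenfattoEtAl1978] source
chain behind the (α)-row `h324c`; ROW 4 of `N08-PORT-MAP-CLUSTER-SIDE.md` §1).  `…B1Eq324BenfattoSect5TupleClustersDecay` (seat n08-c) proves, for
the CONDITIONED FREE FIELD `P̄(dz|z̄_Γ) = condField d α β Γ z̄`, Appendix D with the decay factor split over the slots («max ≥ mean»: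
*"the exponential factors arising from i) and ii) give rise to an overall dumping factor"*, App. D p. 166), the supplier of the CROSS terms of
the pavement step (`…Sect5FreeStepCross.abs_ursellOf_le_of_anchored`, seat n08-b, at `Γ = ∅`).  Its proof reads the free field through exactly
three facts: the centre bound `|u| ≤ K₀` on the legs (a HYPOTHESIS already), the integrability of monomials, and the covariance decay
`|C^Γ(x,y)| ≤ C₀₀·θ^{ℓ¹(x,y)}` (F4, `…AppendixDWick.abs_condCov_le_exp_l1`, at the free rate `log((2d+α²)/2d)`).  The class road (seats
n08-b/n08-c/n08-d; `N08-BASICLEMMA-KERNEL-CENSUS.md`, the two PORT-MAP memos) needs the same statement for the SHIFTED KERNEL FIELD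
`μ_{K,u} := (gaussianFieldOfKernel K).map (fun ζ y => u y + ζ y)` of a GENERIC positive-semidefinite kernel `K` on `Q₀ = Site d` and a
GENERIC centre `u` (the part fields `N^K_{P,ξ}` of `…KernelSect5Eq513`), with the three facts as ROWS: R0 `hK : IsPosSemidefKernel K`,
R1 `hdiag : ∀ y, K y y ≤ c₀` (integrability, via row 2 `…KernelSect5PolyClusters.integrable_abs_monomial_pow_shift`), R2
`hdec : ∀ x y, |K x y| ≤ K₀·exp(−(δ₀·ℓ¹(x,y)))` (ONE decay row at a free rate `δ₀`, read at any `0 ≤ δ ≤ δ₀` — the shape of row 3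
`…KernelSect5TupleClusters`, so that rows 3/4/5 read the same row), R3 `hu : |u| ≤ K₀` on the legs.  This file is that edition: the SAME
proofs with `abs_ursellOf_monomials_condField_le_exp ↦ …KernelSect5PolyClusters.abs_ursellOf_monomials_shift_le_exp` (row 2, seat n08-c) and
F4 replaced by R2; the slot geometry (`…Sect5TupleClusters` §1/§3: `tupleSum_eq_sum_option`, `sum_abs_tcoef_mul_eq`, `l1_site_pseudo`,
`sum_sum_l1_legs_le`, `appDConst_mono`; `…TupleClustersDecay.exp_neg_max_le_prod_exp_neg_mean`) is measure-free and consumed BY NAME.  The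
currency is written as the literal term `(gaussianFieldOfKernel K).map fun (ζ : Site d → ℝ) (y : Site d) => u y + ζ y` everywhere
(`…KernelAppendixD` §1 / `…KernelCondToFree` §1 / `…KernelSect5Eq513` / memo §5.2), so that consumers close by `exact`; §3 gives the faces for
the CENTRED field `gaussianFieldOfKernel K` (`u = 0`: print's `𝓔̂^T_0`, the free side's `K_ref = K_Λ`).

DICTIONARY.  `μ_{K,u}` ↦ `(gaussianFieldOfKernel K).map fun ζ y => u y + ζ y`; rows R0 ↦ `hK`, R1 ↦ `hdiag` (`c₀ : ℝ≥0`), R2 ↦ `hdec`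
(`K₀ ≥ 1`, `δ₀`), R3 ↦ `hu`; slots, masses `𝓜̃_j^{c·ρ} = Σ_{T_j}|A^n_Δ|e^{−(ϰ/2)d(Δ)}e^{(δ/2)D²(√d·d(Δ)+d)}·e^{−c·ρ(Δ₀)}` and the constant
`C = 2^{kD}2^{2^{kD}}K₀^{kD}` exactly as in the concrete module.  The concrete module is the instance `K := condCov (freeCov d α β) Γ`,
`u := condMean (freeCov d α β) Γ z̄`, `c₀ := (freeCov d α β 0 0)⁺`, `δ₀ := log((2d+α²)/2d)`, `K₀ ≥ max(1, C₀₀)` (`…Sect5SlotMoments.condField_eq_map`, `rfl`;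
R2 from `abs_condCov_le_exp_l1`).

WHAT IS PROVED (theorems only; no definition, no named fact, no `sorry`; axioms standard).
* §1 ★ `abs_ursellOf_poly_shift_le_prod_decayMass` — generic finite-index form under `μ_{K,u}`: with a weight `ρ_c` per index such that every
  non-zero colouring has, for EVERY slot `j`, a leg of `f(j₁)` and a leg of `f(j)` at `ℓ¹` distance `≥ ρ_{f(j)}`,
  `|𝓔^T_{μ_{K,u}}(Z₁,…,Z_k)| ≤ 2^{kD}2^{2^{kD}}K₀^{kD}·Π_j Σ_c |a_{jc}|·e^{(δ/2)θ_c}·e^{−(δ/(2k))ρ_c}` (`0 ≤ δ ≤ δ₀`).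
* §2 ★★ **`abs_ursellOf_tupleSums_shift_le_prod_decayMass`** — tuple-class slots under `μ_{K,u}`: if every tuple of the class of slot `j₁` meets
  `R_A` and `ρ(y) ≤ ℓ¹(x, y)` for all `x ∈ R_A`, then
  `|𝓔^T_{μ_{K,u}}(Y₁,…,Y_k)| ≤ 2^{kD}2^{2^{kD}}K₀^{kD}·Π_j Σ_{p,Δ∈T_j p,n}|A^n_Δ|e^{−(ϰ/2)d(Δ)}·e^{(δ/2)D²(√d·d(Δ)+d)}·e^{−(δ/(2k))·ρ(Δ₀)}`.
* §3 `abs_ursellOf_tupleSums_kernel_le_prod_decayMass` — the same under the CENTRED `gaussianFieldOfKernel K` (row R3 discharged at `u = 0`).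

HONEST SCOPE / NOT HERE.  (i) The rows are DISPLAYED, not discharged — at the class's per-box instance `(K_□, u_{Γ₁}(ξ))` they are
`…KernelOfPrecision.condCov_kernel_self_pos_le` / `abs_condCov_kernel_le_exp` / `abs_condMean_kernel_le_profile` (or `…ClassAppendixC` on the
sub-precision) composed with a comparison of the class's distance with `ℓ¹` — the instantiation row's business (port map §1 last row, §2);
(ii) the anchored lattice sums of the decay-weighted masses (`…SlotMasses`, `…CrossCount`, `…RegionCount` — measure-free, reused AS IS), the
palette bookkeeping and the error collection are the free side's / the assembly's; (iii) one self-located row of an UNCOMMISSIONED port (plan g81 (II),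
START-LIST v11 §n08; lane word n08-c g31 I.30870): nothing is chained to it here; no generalised Basic Lemma is stated; nothing of [Balaban1985UV3]
(41)/(47)/(5) is asserted; count-neutral for N08; nothing about d = 4, the continuum, OS axioms, a mass gap or the Clay problem.
-/

open Finset MeasureTheory
open scoped BigOperators NNReal

namespace Literature.MathematicalPhysics.QuantumFieldTheory.Balaban1983to89.B1Eq324BenfattoKernelSect5TupleClustersDecay

open _root_.MeasureTheory _root_.ProbabilityTheory
open Literature.Probability.LatticeModels (ursellOf)
open Literature.MathematicalPhysics.QuantumFieldTheory
open Literature.MathematicalPhysics.QuantumFieldTheory.Balaban1983to89.B1Eq324BenfattoLemma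
open Literature.MathematicalPhysics.QuantumFieldTheory.Balaban1983to89.B1Eq324BenfattoConnLength (connLength_nonneg)
open Literature.MathematicalPhysics.QuantumFieldTheory.Balaban1983to89.B1Eq324BenfattoSect5Eq511 (term)
open Literature.MathematicalPhysics.QuantumFieldTheory.Balaban1983to89.B1Eq324BenfattoSect5PolyClusters
  (ursellOf_poly_eq_sum_colourings measurable_monomial)
open Literature.MathematicalPhysics.QuantumFieldTheory.Balaban1983to89.B1Eq324BenfattoKernelSect5PolyClusters
  (abs_ursellOf_monomials_shift_le_exp integrable_abs_monomial_pow_shift)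
open Literature.MathematicalPhysics.QuantumFieldTheory.Balaban1983to89.B1Eq324BenfattoSect5TupleClusters
  (tupleSum_eq_sum_option sum_abs_tcoef_mul_eq card_legs_le_of_mem site_of_mem_legs leg_mem_legs_of_mem l1_site_pseudo
   sum_sum_l1_legs_le appDConst_mono)
open Literature.MathematicalPhysics.QuantumFieldTheory.Balaban1983to89.B1Eq324BenfattoSect5TupleClustersDecay
  (exp_neg_max_le_prod_exp_neg_mean)

variable {d : ℕ} {K : B1Eq324BenfattoLemma.Site d → B1Eq324BenfattoLemma.Site d → ℝ}
variable {s D : ℕ} {ϰ : ℝ} {a : Coef d} {Jr : Finset (B1Eq324BenfattoLemma.Site d)}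
variable {σ : Type} [Fintype σ] [DecidableEq σ] [Nonempty σ]

/-- Shifting by the zero centre does nothing. [folklore] -/
private theorem map_add_zero_eq' (μ : Measure (B1Eq324BenfattoLemma.Site d → ℝ)) :
    (μ.map fun (ζ : B1Eq324BenfattoLemma.Site d → ℝ) (y : B1Eq324BenfattoLemma.Site d) => (0 : ℝ) + ζ y) = μ := by
  have h : (fun (ζ : B1Eq324BenfattoLemma.Site d → ℝ) (y : B1Eq324BenfattoLemma.Site d) => (0 : ℝ) + ζ y) = id := by
    funext ζ y
    simp
  rw [h, Measure.map_id]

/-- One decay row read at a smaller rate: `|K x y| ≤ K₀e^{−δ₀ρ}` with `ρ ≥ 0`, `K₀ ≥ 0` and `0 ≤ δ ≤ δ₀` give `|K x y| ≤ K₀e^{−δρ}`. [folklore] -/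
private theorem dec_of_le {K₀ δ₀ δ r t : ℝ} (hK₀ : 0 ≤ K₀) (hr : 0 ≤ r) (hδle : δ ≤ δ₀)
    (h : t ≤ K₀ * Real.exp (-(δ₀ * r))) : t ≤ K₀ * Real.exp (-(δ * r)) :=
  h.trans (mul_le_mul_of_nonneg_left (Real.exp_le_exp.2 (by nlinarith [mul_le_mul_of_nonneg_right hδle hr])) hK₀)

/-! ## §1  Appendix D with the decay distributed over the slots, generic finite-index form under `μ_{K,u}` -/

/-- **APPENDIX D WITH THE DECAY DISTRIBUTED OVER THE SLOTS, GENERIC FINITE-INDEX FORM, SHIFTED KERNEL FIELD**: slots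
`Z_j = Σ_c a_{jc}·Π_{l∈J_c} z(x_{cl})` under `μ_{K,u} = 𝒩(0,K)∘(u + ·)⁻¹` (rows R0 `hK`, R1 `hdiag`, R2 `hdec : |K x y| ≤ K₀e^{−δ₀ℓ¹(x,y)}`,
R3 `|u| ≤ K₀` on the legs, `K₀ ≥ 1`; `≤ D` legs and intra-cluster `ℓ¹` sum `≤ θ_c` per index; rate `0 ≤ δ ≤ δ₀`), a weight `ρ_c` per index
such that every colouring with non-zero coefficients has, for EVERY slot `j`, a leg of `f(j₁)` and a leg of `f(j)` at `ℓ¹` distance `≥ ρ_{f(j)}`: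
`|𝓔^T_{μ_{K,u}}(Z₁,…,Z_k)| ≤ 2^{kD}·2^{2^{kD}}·K₀^{kD}·Π_j Σ_c |a_{jc}|·e^{(δ/2)θ_c}·e^{−(δ/(2k))ρ_c}` — per colouring the designated pair is taken
at the slot with the LARGEST `ρ`, and `e^{−(δ/2)max} ≤ Π_j e^{−(δ/2k)ρ_{f(j)}}`.  The concrete `…TupleClustersDecay.abs_ursellOf_poly_condField_le_prod_decayMass`
is the instance `K := condCov (freeCov d α β) Γ`, `u := condMean … z̄`, `δ₀ := log((2d+α²)/2d)`. [cite: BenfattoEtAl1978, Appendix D p.166 and §5 p.159] -/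
theorem abs_ursellOf_poly_shift_le_prod_decayMass {ι : Type*} [Fintype ι] [Nonempty ι] {κ : Type}
    (hK : IsPosSemidefKernel K) (u : B1Eq324BenfattoLemma.Site d → ℝ) {c₀ : ℝ≥0} (hdiag : ∀ y, K y y ≤ c₀)
    (ac : σ → ι → ℝ) (Jm : ι → Finset κ) (xs : ι → κ → B1Eq324BenfattoLemma.Site d) {K₀ δ₀ : ℝ} (hK₀ : 1 ≤ K₀)
    (hdec : ∀ x y : B1Eq324BenfattoLemma.Site d, |K x y| ≤ K₀ * Real.exp (-(δ₀ * ∑ jj, |((x jj : ℝ) - (y jj : ℝ))|)))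
    (hu : ∀ c, ∀ l ∈ Jm c, |u (xs c l)| ≤ K₀)
    (hq : ∀ c, (Jm c).card ≤ D) (θ : ι → ℝ)
    (hθ : ∀ c, ∑ l ∈ Jm c, ∑ l' ∈ Jm c, ∑ jj, |((xs c l jj : ℝ) - (xs c l' jj : ℝ))| ≤ θ c)
    {δ : ℝ} (hδ : 0 ≤ δ) (hδle : δ ≤ δ₀)
    (j₁ : σ) (ρ : ι → ℝ)
    (hsep : ∀ f : σ → ι, (∀ j, ac j (f j) ≠ 0) → ∀ j,
      ∃ l₁ ∈ Jm (f j₁), ∃ l₂ ∈ Jm (f j), ρ (f j) ≤ ∑ jj, |((xs (f j₁) l₁ jj : ℝ) - (xs (f j) l₂ jj : ℝ))|) :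
    |ursellOf (fun P : Finset σ => ∫ z, ∏ j ∈ P, (∑ c, ac j c * ∏ l ∈ Jm c, z (xs c l))
        ∂((gaussianFieldOfKernel K).map fun (ζ : B1Eq324BenfattoLemma.Site d → ℝ) (y : B1Eq324BenfattoLemma.Site d) => u y + ζ y))
        Finset.univ| ≤
      2 ^ (Fintype.card σ * D) * 2 ^ 2 ^ (Fintype.card σ * D) * K₀ ^ (Fintype.card σ * D) *
        ∏ j, ∑ c, |ac j c| * Real.exp (δ / 2 * θ c) * Real.exp (-(δ / (2 * Fintype.card σ) * ρ c)) := by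
  haveI := isProbabilityMeasure_gaussianFieldOfKernel hK
  have hTm : Measurable (fun (ζ : B1Eq324BenfattoLemma.Site d → ℝ) (y : B1Eq324BenfattoLemma.Site d) => u y + ζ y) :=
    measurable_pi_lambda _ fun y => measurable_const.add (measurable_pi_apply y)
  haveI : IsProbabilityMeasure ((gaussianFieldOfKernel K).map
      fun (ζ : B1Eq324BenfattoLemma.Site d → ℝ) (y : B1Eq324BenfattoLemma.Site d) => u y + ζ y) :=
    Measure.isProbabilityMeasure_map hTm.aemeasurable
  obtain ⟨h0, hsymm, htri, hnn⟩ := l1_site_pseudo (d := d)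
  have hK₀0 : 0 ≤ K₀ := zero_le_one.trans hK₀
  have hCov : ∀ x y : B1Eq324BenfattoLemma.Site d, |K x y| ≤
      K₀ * Real.exp (-(δ * ∑ jj, |((x jj : ℝ) - (y jj : ℝ))|)) :=
    fun x y => dec_of_le hK₀0 (hnn x y) hδle (hdec x y)
  have hm : ∀ (j : σ) (c : ι), AEStronglyMeasurable (fun z : B1Eq324BenfattoLemma.Site d → ℝ => ∏ l ∈ Jm c, z (xs c l))
      ((gaussianFieldOfKernel K).map
        fun (ζ : B1Eq324BenfattoLemma.Site d → ℝ) (y : B1Eq324BenfattoLemma.Site d) => u y + ζ y) :=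
    fun j c => (measurable_monomial (Jm c) (xs c)).aestronglyMeasurable
  have hint : ∀ (j : σ) (c : ι) (q : ℕ), q ≤ Fintype.card σ →
      Integrable (fun z : B1Eq324BenfattoLemma.Site d → ℝ => |∏ l ∈ Jm c, z (xs c l)| ^ q)
        ((gaussianFieldOfKernel K).map
          fun (ζ : B1Eq324BenfattoLemma.Site d → ℝ) (y : B1Eq324BenfattoLemma.Site d) => u y + ζ y) :=
    fun j c q _ => integrable_abs_monomial_pow_shift hK u hdiag (Jm c) (xs c) q
  rw [ursellOf_poly_eq_sum_colourings
    (μ := (gaussianFieldOfKernel K).map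
      fun (ζ : B1Eq324BenfattoLemma.Site d → ℝ) (y : B1Eq324BenfattoLemma.Site d) => u y + ζ y) ac
    (fun (_ : σ) (c : ι) (z : B1Eq324BenfattoLemma.Site d → ℝ) => ∏ l ∈ Jm c, z (xs c l)) hm hint]
  set C := (2 : ℝ) ^ (Fintype.card σ * D) * 2 ^ 2 ^ (Fintype.card σ * D) * K₀ ^ (Fintype.card σ * D) with hC
  have hC0 : 0 ≤ C := by positivity
  have hf : ∀ f : σ → ι,
      |(∏ j, ac j (f j)) * ursellOf (fun P : Finset σ => ∫ z, ∏ j ∈ P, ∏ l ∈ Jm (f j), z (xs (f j) l)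
        ∂((gaussianFieldOfKernel K).map
          fun (ζ : B1Eq324BenfattoLemma.Site d → ℝ) (y : B1Eq324BenfattoLemma.Site d) => u y + ζ y)) Finset.univ| ≤
        C * ∏ j, (|ac j (f j)| * Real.exp (δ / 2 * θ (f j)) * Real.exp (-(δ / (2 * Fintype.card σ) * ρ (f j)))) := by
    intro f
    by_cases hgood : ∀ j, ac j (f j) ≠ 0
    · -- the slot whose chosen index carries the largest weight
      obtain ⟨jm, -, hjm⟩ := Finset.exists_max_image (Finset.univ : Finset σ) (fun j => ρ (f j)) Finset.univ_nonempty
      obtain ⟨l₁, hl₁, l₂, hl₂, hρM⟩ := hsep f hgood jm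
      have hAD := abs_ursellOf_monomials_shift_le_exp hK u (fun j => Jm (f j)) (fun j => xs (f j))
        (fun x y : B1Eq324BenfattoLemma.Site d => ∑ jj, |((x jj : ℝ) - (y jj : ℝ))|) h0 hsymm htri hnn hK₀ hδ
        (fun j l hl => hu (f j) l hl) (fun j j' l _ l' _ => hCov (xs (f j) l) (xs (f j') l')) hl₁ hl₂
      have hN : ∑ j, (Jm (f j)).card ≤ Fintype.card σ * D := by
        calc ∑ j, (Jm (f j)).card ≤ ∑ _j : σ, D := Finset.sum_le_sum fun j _ => hq (f j)
          _ = Fintype.card σ * D := by rw [Finset.sum_const, smul_eq_mul, Finset.card_univ]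
      have hI : ∑ j, ∑ l ∈ Jm (f j), ∑ l' ∈ Jm (f j), (∑ jj, |((xs (f j) l jj : ℝ) - (xs (f j) l' jj : ℝ))|) ≤ ∑ j, θ (f j) :=
        Finset.sum_le_sum fun j _ => hθ (f j)
      have hmax := exp_neg_max_le_prod_exp_neg_mean (σ := σ) hδ (fun j => ρ (f j)) fun j => hjm j (Finset.mem_univ j)
      have hexp : Real.exp (-(δ / 2 * ((∑ jj, |((xs (f j₁) l₁ jj : ℝ) - (xs (f jm) l₂ jj : ℝ))|) -
          ∑ j, ∑ l ∈ Jm (f j), ∑ l' ∈ Jm (f j), ∑ jj, |((xs (f j) l jj : ℝ) - (xs (f j) l' jj : ℝ))|))) ≤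
          (∏ j, Real.exp (-(δ / (2 * Fintype.card σ) * ρ (f j)))) * ∏ j, Real.exp (δ / 2 * θ (f j)) := by
        refine le_trans ?_ (mul_le_mul_of_nonneg_right hmax (Finset.prod_nonneg fun j _ => (Real.exp_pos _).le))
        rw [← Real.exp_sum, ← Real.exp_add, Real.exp_le_exp, ← Finset.mul_sum]
        nlinarith
      rw [abs_mul, Finset.abs_prod]
      calc (∏ j, |ac j (f j)|) * |ursellOf (fun P : Finset σ => ∫ z, ∏ j ∈ P, ∏ l ∈ Jm (f j), z (xs (f j) l)
              ∂((gaussianFieldOfKernel K).map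
                fun (ζ : B1Eq324BenfattoLemma.Site d → ℝ) (y : B1Eq324BenfattoLemma.Site d) => u y + ζ y)) Finset.univ|
          ≤ (∏ j, |ac j (f j)|) * (C * ((∏ j, Real.exp (-(δ / (2 * Fintype.card σ) * ρ (f j)))) *
              ∏ j, Real.exp (δ / 2 * θ (f j)))) := by
            refine mul_le_mul_of_nonneg_left (hAD.trans ?_) (Finset.prod_nonneg fun j _ => abs_nonneg _)
            calc (2 : ℝ) ^ (∑ j, (Jm (f j)).card) * 2 ^ 2 ^ (∑ j, (Jm (f j)).card) * (K₀ ^ (∑ j, (Jm (f j)).card) *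
                  Real.exp (-(δ / 2 * ((∑ jj, |((xs (f j₁) l₁ jj : ℝ) - (xs (f jm) l₂ jj : ℝ))|) -
                    ∑ j, ∑ l ∈ Jm (f j), ∑ l' ∈ Jm (f j), ∑ jj, |((xs (f j) l jj : ℝ) - (xs (f j) l' jj : ℝ))|))))
                = (2 : ℝ) ^ (∑ j, (Jm (f j)).card) * 2 ^ 2 ^ (∑ j, (Jm (f j)).card) * K₀ ^ (∑ j, (Jm (f j)).card) *
                  Real.exp (-(δ / 2 * ((∑ jj, |((xs (f j₁) l₁ jj : ℝ) - (xs (f jm) l₂ jj : ℝ))|) -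
                    ∑ j, ∑ l ∈ Jm (f j), ∑ l' ∈ Jm (f j), ∑ jj, |((xs (f j) l jj : ℝ) - (xs (f j) l' jj : ℝ))|))) := by
                  ring
              _ ≤ C * ((∏ j, Real.exp (-(δ / (2 * Fintype.card σ) * ρ (f j)))) * ∏ j, Real.exp (δ / 2 * θ (f j))) :=
                  mul_le_mul (appDConst_mono hK₀ hN) hexp (Real.exp_pos _).le hC0
        _ = C * ∏ j, (|ac j (f j)| * Real.exp (δ / 2 * θ (f j)) * Real.exp (-(δ / (2 * Fintype.card σ) * ρ (f j)))) := by
            rw [Finset.prod_mul_distrib, Finset.prod_mul_distrib]; ring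
    · obtain ⟨j, hj⟩ := not_forall.1 hgood
      have hj : ac j (f j) = 0 := not_ne_iff.1 hj
      have hprod : ∏ j, ac j (f j) = 0 := Finset.prod_eq_zero (Finset.mem_univ j) hj
      have hprod' : ∏ j, (|ac j (f j)| * Real.exp (δ / 2 * θ (f j)) * Real.exp (-(δ / (2 * Fintype.card σ) * ρ (f j)))) = 0 :=
        Finset.prod_eq_zero (Finset.mem_univ j) (by rw [hj, abs_zero, zero_mul, zero_mul])
      rw [hprod, zero_mul, abs_zero, hprod', mul_zero]
  refine (Finset.abs_sum_le_sum_abs _ _).trans ((Finset.sum_le_sum fun f _ => hf f).trans (le_of_eq ?_))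
  rw [← Finset.mul_sum, ← Fintype.prod_sum fun j c =>
    |ac j c| * Real.exp (δ / 2 * θ c) * Real.exp (-(δ / (2 * Fintype.card σ) * ρ c))]

/-! ## §2  Tuple-class slots under `μ_{K,u}` -/

/-- **APPENDIX D WITH THE DECAY DISTRIBUTED OVER THE SLOTS, TUPLE-CLASS FORM, SHIFTED KERNEL FIELD** (the CROSS supplier in its extensive shape):
slots `Y_j = Σ_pΣ_{Δ∈T_j p}Σ_n A^n_Δ e^{−(ϰ/2)d(Δ)} Π z_{Δᵢ}^{nᵢ}` under `μ_{K,u}` (rows R0 `hK`, R1 `hdiag`, R2 `hdec : |K x y| ≤ K₀e^{−δ₀ℓ¹(x,y)}`,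
R3 `|u| ≤ K₀` on the tuples' tesserae, `K₀ ≥ 1`, rate `0 ≤ δ ≤ δ₀`); if every tuple of the class of slot `j₁` meets `R_A` and `ρ : Q₀ → ℝ`
satisfies `ρ(y) ≤ ℓ¹(x, y)` for all `x ∈ R_A` and all `y`, then with the anchor tessera `Δ₀` of each tuple
`|𝓔^T_{μ_{K,u}}(Y₁,…,Y_k)| ≤ 2^{kD}·2^{2^{kD}}·K₀^{kD}·Π_j Σ_{T_j}|A^n_Δ|·e^{−(ϰ/2)d(Δ)}·e^{(δ/2)D²(√d·d(Δ)+d)}·e^{−(δ/(2k))ρ(Δ₀)}`.  The concrete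
`…TupleClustersDecay.abs_ursellOf_tupleSums_condField_le_prod_decayMass` is the instance `K := condCov (freeCov d α β) Γ`, `u := condMean … z̄`.
[cite: BenfattoEtAl1978, Appendix D p.166 and §5 p.159] -/
theorem abs_ursellOf_tupleSums_shift_le_prod_decayMass
    (hK : IsPosSemidefKernel K) (u : B1Eq324BenfattoLemma.Site d → ℝ) {c₀ : ℝ≥0} (hdiag : ∀ y, K y y ≤ c₀)
    (T : σ → (p : ℕ) → Finset (Fin p → Jr)) {K₀ δ₀ : ℝ} (hK₀ : 1 ≤ K₀)
    (hdec : ∀ x y : B1Eq324BenfattoLemma.Site d, |K x y| ≤ K₀ * Real.exp (-(δ₀ * ∑ jj, |((x jj : ℝ) - (y jj : ℝ))|)))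
    (hu : ∀ j, ∀ p ∈ Finset.Icc 1 s, ∀ Δ ∈ T j p, ∀ i, |u (Δ i : B1Eq324BenfattoLemma.Site d)| ≤ K₀)
    {δ : ℝ} (hδ : 0 ≤ δ) (hδle : δ ≤ δ₀)
    (j₁ : σ) (RA : Set (B1Eq324BenfattoLemma.Site d))
    (hA : ∀ p ∈ Finset.Icc 1 s, ∀ Δ ∈ T j₁ p, ∃ i, (Δ i : B1Eq324BenfattoLemma.Site d) ∈ RA)
    (ρ : B1Eq324BenfattoLemma.Site d → ℝ) (hρ : ∀ x ∈ RA, ∀ y, ρ y ≤ ∑ j, |((x j : ℝ) - (y j : ℝ))|) :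
    |ursellOf (fun P : Finset σ => ∫ z, ∏ j ∈ P,
        (∑ p ∈ Finset.Icc 1 s, ∑ Δ ∈ T j p, ∑ n ∈ admissible p D, term ϰ a z p Δ n)
        ∂((gaussianFieldOfKernel K).map fun (ζ : B1Eq324BenfattoLemma.Site d → ℝ) (y : B1Eq324BenfattoLemma.Site d) => u y + ζ y))
        Finset.univ| ≤
      2 ^ (Fintype.card σ * D) * 2 ^ 2 ^ (Fintype.card σ * D) * K₀ ^ (Fintype.card σ * D) *
        ∏ j, ∑ p ∈ Finset.Icc 1 s, ∑ Δ ∈ T j p, ∑ n ∈ admissible p D,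
          |a p (fun i => (Δ i : B1Eq324BenfattoLemma.Site d)) n| *
            Real.exp (-(ϰ / 2) * connLength fun i => (Δ i : B1Eq324BenfattoLemma.Site d)) *
            (Real.exp (δ / 2 * ((D : ℝ) ^ 2 * (Real.sqrt d * connLength (fun i => (Δ i : B1Eq324BenfattoLemma.Site d)) + d))) *
              Real.exp (-(δ / (2 * Fintype.card σ) *
                ρ (if h : 0 < p then (Δ ⟨0, h⟩ : B1Eq324BenfattoLemma.Site d) else (0 : B1Eq324BenfattoLemma.Site d))))) := by
  classical
  simp_rw [tupleSum_eq_sum_option T]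
  have hmem : ∀ c : ↥((Finset.Icc 1 s).sigma fun p =>
      (Finset.univ.filter fun Δ : Fin p → Jr => ∃ j', Δ ∈ T j' p) ×ˢ admissible p D),
      c.1.1 ∈ Finset.Icc 1 s ∧ (∃ j', c.1.2.1 ∈ T j' c.1.1) ∧ c.1.2.2 ∈ admissible c.1.1 D := by
    intro c
    have h := Finset.mem_sigma.1 c.2
    have h2 := Finset.mem_product.1 h.2
    exact ⟨h.1, (Finset.mem_filter.1 h2.1).2, h2.2⟩
  have hpos : ∀ c : ↥((Finset.Icc 1 s).sigma fun p =>
      (Finset.univ.filter fun Δ : Fin p → Jr => ∃ j', Δ ∈ T j' p) ×ˢ admissible p D), 0 < c.1.1 :=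
    fun c => (Finset.mem_Icc.1 (hmem c).1).1
  refine (abs_ursellOf_poly_shift_le_prod_decayMass (D := D) hK u hdiag _ _ _ hK₀ hdec ?_ ?_
    (fun c : Option ↥((Finset.Icc 1 s).sigma fun p =>
        (Finset.univ.filter fun Δ : Fin p → Jr => ∃ j', Δ ∈ T j' p) ×ˢ admissible p D) => c.elim 0 fun c =>
      (D : ℝ) ^ 2 * (Real.sqrt d * connLength (fun i => (c.1.2.1 i : B1Eq324BenfattoLemma.Site d)) + d)) ?_ hδ hδle j₁
    (fun c : Option ↥((Finset.Icc 1 s).sigma fun p =>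
        (Finset.univ.filter fun Δ : Fin p → Jr => ∃ j', Δ ∈ T j' p) ×ˢ admissible p D) => c.elim 0 fun c =>
      ρ (c.1.2.1 ⟨0, hpos c⟩ : B1Eq324BenfattoLemma.Site d)) ?_).trans (le_of_eq ?_)
  · rintro (_ | c) l hl
    · simp only [Option.elim_none, Finset.notMem_empty] at hl
    · simp only [Option.elim_some] at hl ⊢
      obtain ⟨i, hi⟩ := site_of_mem_legs (Jr := Jr) (Δ := c.1.2.1) hl
      obtain ⟨hp, ⟨j', hj'⟩, -⟩ := hmem c
      rw [hi]; exact hu j' _ hp _ hj' i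
  · rintro (_ | c)
    · simp only [Option.elim_none, Finset.card_empty]; exact Nat.zero_le _
    · simp only [Option.elim_some]; exact card_legs_le_of_mem (hmem c).2.2
  · rintro (_ | c)
    · simp only [Option.elim_none, Finset.sum_empty]; exact le_rfl
    · simp only [Option.elim_some]
      exact sum_sum_l1_legs_le (D := D) c.1.2.1 (hmem c).2.2
  · intro f hf j
    have hcls : ∀ j, ∃ c, f j = some c ∧ c.1.2.1 ∈ T j c.1.1 := by
      intro j
      have h := hf j
      rcases hfj : f j with _ | c
      · rw [hfj] at h; exact absurd rfl h
      · rw [hfj] at h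
        simp only [Option.elim_some] at h
        by_cases hc : c.1.2.1 ∈ T j c.1.1
        · exact ⟨c, rfl, hc⟩
        · exact absurd (if_neg hc) h
    obtain ⟨c₁, hc₁, hT₁⟩ := hcls j₁
    obtain ⟨c₂, hc₂, -⟩ := hcls j
    obtain ⟨i₁, hi₁⟩ := hA _ (hmem c₁).1 _ hT₁
    refine ⟨((i₁ : ℕ), 0), ?_, (((⟨0, hpos c₂⟩ : Fin c₂.1.1) : ℕ), 0), ?_, ?_⟩
    · rw [hc₁]; exact leg_mem_legs_of_mem (hmem c₁).2.2 i₁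
    · rw [hc₂]; exact leg_mem_legs_of_mem (hmem c₂).2.2 ⟨0, hpos c₂⟩
    · rw [hc₁, hc₂]
      simp only [Option.elim_some, Fin.is_lt, dif_pos, Fin.eta]
      rw [dif_pos (hpos c₂)]
      exact hρ _ hi₁ _
  · congr 1
    refine Finset.prod_congr rfl fun j _ => ?_
    rw [Fintype.sum_option]
    simp only [Option.elim_none, Option.elim_some, abs_zero, zero_mul, zero_add]
    have h := sum_abs_tcoef_mul_eq (s := s) (D := D) (ϰ := ϰ) (a := a) T j
      (fun c => Real.exp (δ / 2 * ((D : ℝ) ^ 2 * (Real.sqrt d * connLength (fun i => (c.2.1 i : B1Eq324BenfattoLemma.Site d)) + d))) *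
        Real.exp (-(δ / (2 * Fintype.card σ) *
          ρ (if h : 0 < c.1 then (c.2.1 ⟨0, h⟩ : B1Eq324BenfattoLemma.Site d) else (0 : B1Eq324BenfattoLemma.Site d)))))
    refine Eq.trans (Finset.sum_congr rfl fun c _ => ?_) h
    rw [dif_pos (hpos c), mul_assoc]

/-! ## §3  The centred face `u = 0`: print's `𝓔̂^T_0` / the class road's `K_ref = K_Λ` -/

/-- **APPENDIX D WITH THE DECAY DISTRIBUTED OVER THE SLOTS, TUPLE-CLASS FORM, CENTRED KERNEL FIELD `𝒩(0,K)`**: the instance `u = 0` of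
`abs_ursellOf_tupleSums_shift_le_prod_decayMass` (row R3 discharged), stated for `gaussianFieldOfKernel K` itself — the measure of the free-side
identification (`…KernelSect5FreeStep` §2; `K_ref = K_Λ`); the concrete `P̂₀ = condField d α β ∅ 0` case of `…Sect5FreeStepCross`.
[cite: BenfattoEtAl1978, Appendix D p.166 and §5 p.159] -/
theorem abs_ursellOf_tupleSums_kernel_le_prod_decayMass
    (hK : IsPosSemidefKernel K) {c₀ : ℝ≥0} (hdiag : ∀ y, K y y ≤ c₀)
    (T : σ → (p : ℕ) → Finset (Fin p → Jr)) {K₀ δ₀ : ℝ} (hK₀ : 1 ≤ K₀)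
    (hdec : ∀ x y : B1Eq324BenfattoLemma.Site d, |K x y| ≤ K₀ * Real.exp (-(δ₀ * ∑ jj, |((x jj : ℝ) - (y jj : ℝ))|)))
    {δ : ℝ} (hδ : 0 ≤ δ) (hδle : δ ≤ δ₀)
    (j₁ : σ) (RA : Set (B1Eq324BenfattoLemma.Site d))
    (hA : ∀ p ∈ Finset.Icc 1 s, ∀ Δ ∈ T j₁ p, ∃ i, (Δ i : B1Eq324BenfattoLemma.Site d) ∈ RA)
    (ρ : B1Eq324BenfattoLemma.Site d → ℝ) (hρ : ∀ x ∈ RA, ∀ y, ρ y ≤ ∑ j, |((x j : ℝ) - (y j : ℝ))|) :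
    |ursellOf (fun P : Finset σ => ∫ z, ∏ j ∈ P,
        (∑ p ∈ Finset.Icc 1 s, ∑ Δ ∈ T j p, ∑ n ∈ admissible p D, term ϰ a z p Δ n) ∂(gaussianFieldOfKernel K))
        Finset.univ| ≤
      2 ^ (Fintype.card σ * D) * 2 ^ 2 ^ (Fintype.card σ * D) * K₀ ^ (Fintype.card σ * D) *
        ∏ j, ∑ p ∈ Finset.Icc 1 s, ∑ Δ ∈ T j p, ∑ n ∈ admissible p D,
          |a p (fun i => (Δ i : B1Eq324BenfattoLemma.Site d)) n| *
            Real.exp (-(ϰ / 2) * connLength fun i => (Δ i : B1Eq324BenfattoLemma.Site d)) *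
            (Real.exp (δ / 2 * ((D : ℝ) ^ 2 * (Real.sqrt d * connLength (fun i => (Δ i : B1Eq324BenfattoLemma.Site d)) + d))) *
              Real.exp (-(δ / (2 * Fintype.card σ) *
                ρ (if h : 0 < p then (Δ ⟨0, h⟩ : B1Eq324BenfattoLemma.Site d) else (0 : B1Eq324BenfattoLemma.Site d))))) := by
  have h := abs_ursellOf_tupleSums_shift_le_prod_decayMass (s := s) (D := D) (ϰ := ϰ) (a := a) hK (fun _ => (0 : ℝ)) hdiag T hK₀
    hdec (fun j p _ Δ _ i => by rw [abs_zero]; exact zero_le_one.trans hK₀) hδ hδle j₁ RA hA ρ hρ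
  rwa [map_add_zero_eq'] at h

end Literature.MathematicalPhysics.QuantumFieldTheory.Balaban1983to89.B1Eq324BenfattoKernelSect5TupleClustersDecay
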